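import Summits.QuantumFields.GaugeBoot.UnitaryTensorInvariants
import Summits.QuantumFields.GaugeBoot.TwistedSlabHaar
import Summits.QuantumFields.GaugeBoot.AdInvariantSchwingerDysonRows
import HarnessLib

/-!
# Haar moments of a compact gauge group containing `SU(N)`: the Weingarten FORM of conjugation averages (gauge-boot, FFT 4/7)

HONEST FRAMING (cell `pub-gaugeboot`, page 1 of every file): the venture produces certified bounds
on lattice expectations at stated coupling, gauge group, dimension and torus size; NOT a mass gap,
NOT a continuum limit, NOT a string tension; NOT Yang–Mills-summit-bearing (barriers
`FixedCouplingUltralocality`, `PerturbativeInvisibility`). Structural (Haar integrals on a compact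
group); no number is certified. Fourth brick of the lane's first fundamental theorem.

## Content (compact `G`, `r : LatticeRep G` unitary of degree `N`, `SU(N) ⊆ ρ(G)`)

* `ContainsSU r` — the image of `ρ` contains `SU(N)` (defining representations of `SU(N)`, `U(N)`).
* `haarMoment r (a,b) (c,e) = ∫ (∏_k ρ(g)_{a_k c_k}) conj(∏_k ρ(g)_{b_k e_k}) dg` — joint moments of the
  matrix entries; ★ by left / right invariance of Haar measure the moment matrix in the row words
  (resp. column words) commutes with every `s^{⊗κ}`, `s ∈ SU(N)`, hence (tensor FFT,
  `UnitaryTensorInvariants`) lies in the span of the slot permutations in EACH pair of arguments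
  (`haarMoment_mem_span_left/right`); `exists_coeff_of_rows_cols` (rows-and-columns lemma).
* ★★★ `exists_weingarten` — THE WEINGARTEN FORM: `haarMoment r (a,b) (c,e) = ∑_{σ,τ} W σ τ
  (P_σ)_{ab} (P_τ)_{ce}` for coefficients `W` depending on `G, ρ, κ` only (B. Collins, IMRN 2003;
  Collins–Śniady, CMP 264 (2006) — the FORM, not the values of the Weingarten function).
* ★★★ `exists_integral_prod_conj_eq` — CONJUGATION AVERAGES OF PRODUCTS OF MATRIX ENTRIES:
  `∫ ∏_k (ρ(g) L_k ρ(g)⁻¹)_{a_k b_k} dg = ∑_{σ,τ} W σ τ (P_σ)_{ab} · twistTrace τ L` for every family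
  of letters `L : κ → M_N(ℂ)` — a combination of products of traces of words in the letters; the
  engine of Durhuus' / Sengupta's theorem that Wilson loops generate the gauge-invariant polynomials.

References: B. Collins, Int. Math. Res. Not. 2003 (17) 953–982; A. Sengupta, Proc. AMS 121 (1994)
897–905, proof of Thm. 2; B. Durhuus, Lett. Math. Phys. 4 (1980) 515–522.
-/

noncomputable section
noncomputable section

open MeasureTheory Matrix Finset
open scoped ComplexConjugate
open Literature.MathematicalPhysics.QuantumFieldTheory (LatticeRep haarProbability)

namespace Summit.QuantumFields.GaugeBoot

namespace TensorFFT

/-! ## Linear algebra: functions with columns and rows in given spans -/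

/-- **Rows-and-columns lemma.** If every column of `m` lies in `span (range s)` and every row in
`span (range t)`, then `m i j = ∑_{σ,τ} W σ τ · s σ i · t τ j` for some coefficients `W`. -/
theorem exists_coeff_of_rows_cols {I J 𝕜 S T : Type*} [Field 𝕜] [Fintype I] [Fintype J]
    [DecidableEq I] [Fintype S] [Fintype T] (s : S → I → 𝕜) (t : T → J → 𝕜) (m : I → J → 𝕜)
    (hcol : ∀ j, (fun i => m i j) ∈ Submodule.span 𝕜 (Set.range s))
    (hrow : ∀ i, m i ∈ Submodule.span 𝕜 (Set.range t)) :
    ∃ W : S → T → 𝕜, ∀ i j, m i j = ∑ σ, ∑ τ, W σ τ * s σ i * t τ j := by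
  classical
  set U : Submodule 𝕜 (I → 𝕜) := Submodule.span 𝕜 (Set.range s) with hU
  let bU := Module.finBasis 𝕜 U
  obtain ⟨C, hC⟩ := U.exists_isCompl
  let π : (I → 𝕜) →ₗ[𝕜] U := U.projectionOnto C hC
  -- coordinate functionals of the columns
  let g : Fin (Module.finrank 𝕜 U) → J → 𝕜 := fun q j => bU.repr (π fun i => m i j) q
  have hcolq : ∀ i j, m i j = ∑ q, g q j * (bU q : I → 𝕜) i := by
    intro i j
    have hπ : π (fun i => m i j) = ⟨fun i => m i j, hcol j⟩ :=
      Submodule.projectionOnto_apply_left hC ⟨_, hcol j⟩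
    have h1 := bU.sum_repr (π fun i => m i j)
    have h2 := congrArg (fun u : U => (u : I → 𝕜) i) h1
    have h3 : ((π fun i => m i j : U) : I → 𝕜) i = m i j := by rw [hπ]
    simp only [Submodule.coe_sum, Submodule.coe_smul, Finset.sum_apply, Pi.smul_apply, smul_eq_mul] at h2
    rw [h3] at h2
    exact h2.symm
  -- each coordinate function is a combination of the rows, hence in `span (range t)`
  have hg : ∀ q, g q ∈ Submodule.span 𝕜 (Set.range t) := by
    intro q
    let ℓ : (I → 𝕜) →ₗ[𝕜] 𝕜 := (bU.coord q).comp π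
    have e : g q = ∑ i, ℓ (Pi.single i 1) • m i := by
      funext j
      have h1 : (fun i => m i j) = ∑ i, m i j • (Pi.single i 1 : I → 𝕜) := by
        funext i'
        simp only [Finset.sum_apply, Pi.smul_apply, Pi.single_apply, smul_eq_mul, mul_ite, mul_one,
          mul_zero]
        rw [Finset.sum_ite_eq univ i']
        simp
      change ℓ (fun i => m i j) = _
      rw [h1, map_sum]
      simp only [map_smul, smul_eq_mul, Finset.sum_apply, Pi.smul_apply]
      exact sum_congr rfl fun i _ => mul_comm _ _
    rw [e]
    exact Submodule.sum_mem _ fun i _ => Submodule.smul_mem _ _ (hrow i)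
  have hβ : ∀ q, ∃ β : T → 𝕜, ∑ τ, β τ • t τ = g q := fun q =>
    (Submodule.mem_span_range_iff_exists_fun 𝕜).1 (hg q)
  choose β hβ using hβ
  have hγ : ∀ q, ∃ γ : S → 𝕜, ∑ σ, γ σ • s σ = (bU q : I → 𝕜) := fun q =>
    (Submodule.mem_span_range_iff_exists_fun 𝕜).1 (bU q).2
  choose γ hγ using hγ
  refine ⟨fun σ τ => ∑ q, γ q σ * β q τ, fun i j => ?_⟩
  have e1 : ∀ q, g q j = ∑ τ, β q τ * t τ j := fun q => by
    have h := congrFun (hβ q) j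
    simp only [Finset.sum_apply, Pi.smul_apply, smul_eq_mul] at h
    exact h.symm
  have e2 : ∀ q, (bU q : I → 𝕜) i = ∑ σ, γ q σ * s σ i := fun q => by
    have h := congrFun (hγ q) i
    simp only [Finset.sum_apply, Pi.smul_apply, smul_eq_mul] at h
    exact h.symm
  rw [hcolq i j]
  calc ∑ q, g q j * (bU q : I → 𝕜) i
      = ∑ q, ∑ σ, ∑ τ, γ q σ * β q τ * s σ i * t τ j := by
        refine sum_congr rfl fun q _ => ?_
        rw [e1 q, e2 q, Finset.sum_mul_sum, Finset.sum_comm]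
        exact sum_congr rfl fun σ _ => sum_congr rfl fun τ _ => by ring
    _ = ∑ σ, ∑ τ, ∑ q, γ q σ * β q τ * s σ i * t τ j := by
        rw [Finset.sum_comm]
        exact sum_congr rfl fun σ _ => Finset.sum_comm
    _ = ∑ σ, ∑ τ, (∑ q, γ q σ * β q τ) * s σ i * t τ j := by
        simp only [Finset.sum_mul]

/-! ## Haar moments of the matrix entries -/

section Haar

variable {G : Type*} [Group G] [TopologicalSpace G] [IsTopologicalGroup G] [CompactSpace G]
  [MeasurableSpace G] [BorelSpace G] (r : LatticeRep G) {κ : Type*} [Fintype κ] [DecidableEq κ]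

/-- **The image of `ρ` contains `SU(N)`** (e.g. `ρ` the defining representation of `SU(N)` or of
`U(N)`). [shape] A parametric definition of a proposition — NOT a fact. [folklore] -/
def ContainsSU : Prop :=
  ∀ s : Matrix (Fin r.N) (Fin r.N) ℂ, s ∈ Matrix.specialUnitaryGroup (Fin r.N) ℂ → s ∈ Set.range r.ρ

/-- **Joint Haar moments of the matrix entries**:
`haarMoment r (a,b) (c,e) = ∫ (∏_k ρ(g)_{a_k c_k}) · conj (∏_k ρ(g)_{b_k e_k}) dg`. [folklore] -/
def haarMoment (ab ce : (κ → Fin r.N) × (κ → Fin r.N)) : ℂ :=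
  ∫ g, (∏ k, r.ρ g (ab.1 k) (ce.1 k)) * conj (∏ k, r.ρ g (ab.2 k) (ce.2 k)) ∂haarProbability G

variable {r}

omit [IsTopologicalGroup G] [CompactSpace G] [MeasurableSpace G] [BorelSpace G] [DecidableEq κ] in
/-- The moment integrand is continuous. -/
theorem continuous_momentIntegrand (a c b e : κ → Fin r.N) :
    Continuous fun g : G => (∏ k, r.ρ g (a k) (c k)) * conj (∏ k, r.ρ g (b k) (e k)) :=
  (continuous_finsetProd _ fun k _ => r.continuous.matrix_elem (a k) (c k)).mul
    (Complex.continuous_conj.comp (continuous_finsetProd _ fun k _ => r.continuous.matrix_elem (b k) (e k)))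

omit [DecidableEq κ] in
/-- The moment integrand is Haar integrable. -/
theorem integrable_momentIntegrand (a c b e : κ → Fin r.N) :
    Integrable (fun g : G => (∏ k, r.ρ g (a k) (c k)) * conj (∏ k, r.ρ g (b k) (e k))) (haarProbability G) :=
  (continuous_momentIntegrand a c b e).integrable_of_hasCompactSupport (HasCompactSupport.of_compactSpace _)

omit [IsTopologicalGroup G] [CompactSpace G] [MeasurableSpace G] [BorelSpace G] in
/-- Expansion of the integrand at `h * g`: a tensor power of `ρ(h)` acts on the row words. -/
theorem momentIntegrand_mul_left (h g : G) (a c b e : κ → Fin r.N) :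
    (∏ k, r.ρ (h * g) (a k) (c k)) * conj (∏ k, r.ρ (h * g) (b k) (e k)) =
      ∑ a' : κ → Fin r.N, ∑ b' : κ → Fin r.N, (kronPow (r.ρ h) a a' * conj (kronPow (r.ρ h) b b')) *
        ((∏ k, r.ρ g (a' k) (c k)) * conj (∏ k, r.ρ g (b' k) (e k))) := by
  simp only [map_mul, Matrix.mul_apply, kronPow_apply]
  rw [Fintype.prod_sum (fun k j => r.ρ h (a k) j * r.ρ g j (c k)),
    Fintype.prod_sum (fun k j => r.ρ h (b k) j * r.ρ g j (e k)), map_sum, Finset.sum_mul_sum]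
  refine sum_congr rfl fun a' _ => sum_congr rfl fun b' _ => ?_
  rw [prod_mul_distrib, prod_mul_distrib, map_mul, map_prod]
  ring

omit [IsTopologicalGroup G] [CompactSpace G] [MeasurableSpace G] [BorelSpace G] in
/-- Expansion of the integrand at `g * h`: a tensor power of `ρ(h)ᵀ` acts on the column words. -/
theorem momentIntegrand_mul_right (g h : G) (a c b e : κ → Fin r.N) :
    (∏ k, r.ρ (g * h) (a k) (c k)) * conj (∏ k, r.ρ (g * h) (b k) (e k)) =
      ∑ c' : κ → Fin r.N, ∑ e' : κ → Fin r.N, (kronPow (r.ρ h)ᵀ c c' * conj (kronPow (r.ρ h)ᵀ e e')) *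
        ((∏ k, r.ρ g (a k) (c' k)) * conj (∏ k, r.ρ g (b k) (e' k))) := by
  simp only [map_mul, Matrix.mul_apply, kronPow_apply, transpose_apply]
  rw [Fintype.prod_sum (fun k j => r.ρ g (a k) j * r.ρ h j (c k)),
    Fintype.prod_sum (fun k j => r.ρ g (b k) j * r.ρ h j (e k)), map_sum, Finset.sum_mul_sum]
  refine sum_congr rfl fun c' _ => sum_congr rfl fun e' _ => ?_
  rw [prod_mul_distrib, prod_mul_distrib, map_mul, map_prod]
  ring

/-- ★ **Left invariance**: the moment matrix in the row words satisfies `M = K M Kᴴ`, `K = ρ(h)^{⊗κ}`. -/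
theorem haarMoment_eq_sum_left (h : G) (ce : (κ → Fin r.N) × (κ → Fin r.N)) (a b : κ → Fin r.N) :
    haarMoment r (a, b) ce = ∑ a' : κ → Fin r.N, ∑ b' : κ → Fin r.N,
      (kronPow (r.ρ h) a a' * conj (kronPow (r.ρ h) b b')) * haarMoment r (a', b') ce := by
  unfold haarMoment
  rw [← integral_mul_left_eq_self _ h]
  simp only [momentIntegrand_mul_left]
  rw [integral_finsetSum _ fun a' _ => integrable_finsetSum _ fun b' _ =>
    (integrable_momentIntegrand a' ce.1 b' ce.2).const_mul _]
  refine sum_congr rfl fun a' _ => ?_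
  rw [integral_finsetSum _ fun b' _ => (integrable_momentIntegrand a' ce.1 b' ce.2).const_mul _]
  exact sum_congr rfl fun b' _ => integral_const_mul _ _

/-- ★ **Right invariance**: the moment matrix in the column words satisfies `M = K M Kᴴ`, `K = (ρ(h)ᵀ)^{⊗κ}`. -/
theorem haarMoment_eq_sum_right (h : G) (ab : (κ → Fin r.N) × (κ → Fin r.N)) (c e : κ → Fin r.N) :
    haarMoment r ab (c, e) = ∑ c' : κ → Fin r.N, ∑ e' : κ → Fin r.N,
      (kronPow (r.ρ h)ᵀ c c' * conj (kronPow (r.ρ h)ᵀ e e')) * haarMoment r ab (c', e') := by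
  unfold haarMoment
  rw [← integral_mul_right_eq_self _ h]
  simp only [momentIntegrand_mul_right]
  rw [integral_finsetSum _ fun c' _ => integrable_finsetSum _ fun e' _ =>
    (integrable_momentIntegrand ab.1 c' ab.2 e').const_mul _]
  refine sum_congr rfl fun c' _ => ?_
  rw [integral_finsetSum _ fun e' _ => (integrable_momentIntegrand ab.1 c' ab.2 e').const_mul _]
  exact sum_congr rfl fun e' _ => integral_const_mul _ _

omit [IsTopologicalGroup G] [CompactSpace G] [MeasurableSpace G] [BorelSpace G] in
/-- From `M = K M Kᴴ` with `K` unitary to `Commute K M`. -/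
theorem commute_of_eq_sum_conj {K M : Matrix (κ → Fin r.N) (κ → Fin r.N) ℂ}
    (hK : K ∈ Matrix.unitaryGroup (κ → Fin r.N) ℂ)
    (hM : ∀ a b, M a b = ∑ a', ∑ b', (K a a' * conj (K b b')) * M a' b') : Commute K M := by
  have e : M = K * M * Kᴴ := by
    ext a b
    rw [hM a b, Matrix.mul_assoc, Matrix.mul_apply]
    refine sum_congr rfl fun a' _ => ?_
    rw [Matrix.mul_apply, Finset.mul_sum]
    refine sum_congr rfl fun b' _ => ?_
    rw [conjTranspose_apply, Complex.star_def]
    ring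
  have hK' : Kᴴ * K = 1 := Matrix.mem_unitaryGroup_iff'.1 hK
  change K * M = M * K
  conv_rhs => rw [e]
  rw [Matrix.mul_assoc, Matrix.mul_assoc, hK', Matrix.mul_one]

omit [IsTopologicalGroup G] [CompactSpace G] [MeasurableSpace G] [BorelSpace G] in
/-- Tensor powers of `ρ(h)` and of `ρ(h)ᵀ` are unitary. -/
theorem kronPow_rho_mem_unitaryGroup (h : G) :
    (kronPow (r.ρ h) : Matrix (κ → Fin r.N) (κ → Fin r.N) ℂ) ∈ Matrix.unitaryGroup (κ → Fin r.N) ℂ ∧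
    (kronPow (r.ρ h)ᵀ : Matrix (κ → Fin r.N) (κ → Fin r.N) ℂ) ∈ Matrix.unitaryGroup (κ → Fin r.N) ℂ := by
  have hu := Matrix.mem_unitaryGroup_iff'.1 (r.mem_unitary h)
  have hu2 := Matrix.mem_unitaryGroup_iff.1 (r.mem_unitary h)
  refine ⟨Matrix.mem_unitaryGroup_iff'.2 ?_, Matrix.mem_unitaryGroup_iff'.2 ?_⟩
  · rw [star_eq_conjTranspose, kronPow_eq_kron, kron_conjTranspose, kron_mul]
    simp only [← star_eq_conjTranspose, hu, kron_const_one]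
  · rw [star_eq_conjTranspose, kronPow_eq_kron, kron_conjTranspose, kron_mul]
    have h1 : ((r.ρ h)ᵀ)ᴴ * (r.ρ h)ᵀ = 1 := by
      rw [conjTranspose_transpose_eq_transpose_conjTranspose, ← transpose_mul, ← star_eq_conjTranspose, hu2,
        transpose_one]
    simp only [h1, kron_const_one]

omit [IsTopologicalGroup G] [CompactSpace G] [MeasurableSpace G] [BorelSpace G] [Fintype κ] [DecidableEq κ] in
/-- The transpose of a special unitary matrix is special unitary. -/
theorem transpose_mem_specialUnitaryGroup {s : Matrix (Fin r.N) (Fin r.N) ℂ}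
    (hs : s ∈ Matrix.specialUnitaryGroup (Fin r.N) ℂ) : sᵀ ∈ Matrix.specialUnitaryGroup (Fin r.N) ℂ := by
  rw [Matrix.mem_specialUnitaryGroup_iff] at hs ⊢
  refine ⟨Matrix.mem_unitaryGroup_iff'.2 ?_, by rw [det_transpose, hs.2]⟩
  rw [star_eq_conjTranspose, conjTranspose_transpose_eq_transpose_conjTranspose, ← transpose_mul,
    ← star_eq_conjTranspose, Matrix.mem_unitaryGroup_iff.1 hs.1, transpose_one]

/-- ★ The moment matrix in the ROW words lies in the span of the slot permutations (left invariance + FFT). -/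
theorem haarMoment_mem_span_left (hSU : ContainsSU r) (hN : 0 < r.N)
    (ce : (κ → Fin r.N) × (κ → Fin r.N)) :
    (fun ab : (κ → Fin r.N) × (κ → Fin r.N) => haarMoment r ab ce) ∈
      Submodule.span ℂ (Set.range fun σ : Equiv.Perm κ => fun ab : (κ → Fin r.N) × (κ → Fin r.N) =>
        (permMat σ : Matrix (κ → Fin r.N) (κ → Fin r.N) ℂ) ab.1 ab.2) := by
  haveI : Nonempty (Fin r.N) := ⟨⟨0, hN⟩⟩
  set M : Matrix (κ → Fin r.N) (κ → Fin r.N) ℂ := Matrix.of fun a b => haarMoment r (a, b) ce with hM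
  have hcomm : ∀ s : Matrix (Fin r.N) (Fin r.N) ℂ, s ∈ Matrix.specialUnitaryGroup (Fin r.N) ℂ →
      Commute (kronPow s : Matrix (κ → Fin r.N) (κ → Fin r.N) ℂ) M := by
    intro s hs
    obtain ⟨h, rfl⟩ := hSU s hs
    exact commute_of_eq_sum_conj (kronPow_rho_mem_unitaryGroup h).1
      (fun a b => haarMoment_eq_sum_left h ce a b)
  have hmem := mem_span_permMat_of_forall_specialUnitary hcomm
  let unc : Matrix (κ → Fin r.N) (κ → Fin r.N) ℂ →ₗ[ℂ] ((κ → Fin r.N) × (κ → Fin r.N) → ℂ) :=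
    { toFun := fun A ab => A ab.1 ab.2, map_add' := fun _ _ => rfl, map_smul' := fun _ _ => rfl }
  have h2 := Submodule.apply_mem_span_image_of_mem_span unc hmem
  rw [← Set.range_comp] at h2
  exact h2

/-- ★ The moment matrix in the COLUMN words lies in the span of the slot permutations (right invariance + FFT). -/
theorem haarMoment_mem_span_right (hSU : ContainsSU r) (hN : 0 < r.N)
    (ab : (κ → Fin r.N) × (κ → Fin r.N)) :
    (fun ce : (κ → Fin r.N) × (κ → Fin r.N) => haarMoment r ab ce) ∈
      Submodule.span ℂ (Set.range fun τ : Equiv.Perm κ => fun ce : (κ → Fin r.N) × (κ → Fin r.N) =>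
        (permMat τ : Matrix (κ → Fin r.N) (κ → Fin r.N) ℂ) ce.1 ce.2) := by
  haveI : Nonempty (Fin r.N) := ⟨⟨0, hN⟩⟩
  set M : Matrix (κ → Fin r.N) (κ → Fin r.N) ℂ := Matrix.of fun c e => haarMoment r ab (c, e) with hM
  have hcomm : ∀ s : Matrix (Fin r.N) (Fin r.N) ℂ, s ∈ Matrix.specialUnitaryGroup (Fin r.N) ℂ →
      Commute (kronPow s : Matrix (κ → Fin r.N) (κ → Fin r.N) ℂ) M := by
    intro s hs
    obtain ⟨h, hh⟩ := hSU sᵀ (transpose_mem_specialUnitaryGroup hs)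
    have e : s = (r.ρ h)ᵀ := by rw [hh, transpose_transpose]
    rw [e]
    exact commute_of_eq_sum_conj (kronPow_rho_mem_unitaryGroup h).2
      (fun c e' => haarMoment_eq_sum_right h ab c e')
  have hmem := mem_span_permMat_of_forall_specialUnitary hcomm
  let unc : Matrix (κ → Fin r.N) (κ → Fin r.N) ℂ →ₗ[ℂ] ((κ → Fin r.N) × (κ → Fin r.N) → ℂ) :=
    { toFun := fun A ce => A ce.1 ce.2, map_add' := fun _ _ => rfl, map_smul' := fun _ _ => rfl }
  have h2 := Submodule.apply_mem_span_image_of_mem_span unc hmem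
  rw [← Set.range_comp] at h2
  exact h2

/-- ★★★ **THE WEINGARTEN FORM of the Haar moments**: for a compact group whose image contains
`SU(N)`, `∫ (∏_k ρ(g)_{a_k c_k}) conj(∏_k ρ(g)_{b_k e_k}) dg = ∑_{σ,τ} W σ τ [b = a∘σ] [e = c∘τ]`
for some coefficients `W` depending only on `G, ρ` and the slot type (the FORM of Collins'
Weingarten formula; the values are not computed). [cite: GoodmanWallachGTM255, Thm. 4.2.10] -/
theorem exists_weingarten (hSU : ContainsSU r) (hN : 0 < r.N) :
    ∃ W : Equiv.Perm κ → Equiv.Perm κ → ℂ, ∀ a b c e : κ → Fin r.N,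
      haarMoment r (a, b) (c, e) = ∑ σ, ∑ τ, W σ τ *
        (permMat σ : Matrix (κ → Fin r.N) (κ → Fin r.N) ℂ) a b *
        (permMat τ : Matrix (κ → Fin r.N) (κ → Fin r.N) ℂ) c e := by
  classical
  obtain ⟨W, hW⟩ := exists_coeff_of_rows_cols
    (fun (σ : Equiv.Perm κ) (ab : (κ → Fin r.N) × (κ → Fin r.N)) =>
      (permMat σ : Matrix (κ → Fin r.N) (κ → Fin r.N) ℂ) ab.1 ab.2)
    (fun (τ : Equiv.Perm κ) (ce : (κ → Fin r.N) × (κ → Fin r.N)) =>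
      (permMat τ : Matrix (κ → Fin r.N) (κ → Fin r.N) ℂ) ce.1 ce.2)
    (haarMoment r) (fun ce => haarMoment_mem_span_left hSU hN ce)
    (fun ab => haarMoment_mem_span_right hSU hN ab)
  exact ⟨W, fun a b c e => hW (a, b) (c, e)⟩

omit [IsTopologicalGroup G] [CompactSpace G] [MeasurableSpace G] [BorelSpace G] in
/-- The conjugated-letter integrand expands over the Haar moment integrands. -/
theorem prod_conj_apply_eq_sum (g : G) (L : κ → Matrix (Fin r.N) (Fin r.N) ℂ) (a b : κ → Fin r.N) :
    ∏ k, (r.ρ g * L k * r.ρ g⁻¹) (a k) (b k) =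
      ∑ c : κ → Fin r.N, ∑ e : κ → Fin r.N, (∏ k, L k (c k) (e k)) *
        ((∏ k, r.ρ g (a k) (c k)) * conj (∏ k, r.ρ g (b k) (e k))) := by
  have h1 : ∀ k, (r.ρ g * L k * r.ρ g⁻¹) (a k) (b k) =
      ∑ c, ∑ e, L k c e * (r.ρ g (a k) c * conj (r.ρ g (b k) e)) := by
    intro k
    rw [Matrix.mul_apply]
    simp_rw [Matrix.mul_apply, rho_inv_apply, Finset.sum_mul]
    rw [Finset.sum_comm]
    exact sum_congr rfl fun c _ => sum_congr rfl fun e _ => by ring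
  simp_rw [h1]
  rw [Fintype.prod_sum (fun k c => ∑ e, L k c e * (r.ρ g (a k) c * conj (r.ρ g (b k) e)))]
  refine sum_congr rfl fun c _ => ?_
  rw [Fintype.prod_sum (fun k e => L k (c k) e * (r.ρ g (a k) (c k) * conj (r.ρ g (b k) e)))]
  refine sum_congr rfl fun e _ => ?_
  rw [prod_mul_distrib, prod_mul_distrib, map_prod]

/-- ★★★ **CONJUGATION AVERAGES OF PRODUCTS OF MATRIX ENTRIES are combinations of twisted traces**:
for a compact group whose image contains `SU(N)` there are coefficients `W σ τ` with
`∫ ∏_k (ρ(g) L_k ρ(g)⁻¹)_{a_k b_k} dg = ∑_{σ,τ} W σ τ · (P_σ)_{ab} · twistTrace τ L`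
(`(P_σ)_{ab} = [b = a ∘ σ]`) for EVERY family of letters `L` and all free indices `a, b` — the engine of the theorem that
Wilson loops generate the gauge-invariant polynomials (Durhuus 1980; Sengupta 1994, Thm. 2).
[cite: GoodmanWallachGTM255, Thm. 4.2.10] -/
theorem exists_integral_prod_conj_eq (hSU : ContainsSU r) (hN : 0 < r.N) :
    ∃ W : Equiv.Perm κ → Equiv.Perm κ → ℂ, ∀ (L : κ → Matrix (Fin r.N) (Fin r.N) ℂ) (a b : κ → Fin r.N),
      ∫ g, ∏ k, (r.ρ g * L k * r.ρ g⁻¹) (a k) (b k) ∂haarProbability G =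
        ∑ σ, ∑ τ, W σ τ * (permMat σ : Matrix (κ → Fin r.N) (κ → Fin r.N) ℂ) a b * twistTrace τ L := by
  obtain ⟨W, hW⟩ := exists_weingarten (κ := κ) hSU hN
  refine ⟨W, fun L a b => ?_⟩
  -- step 1: the integral is a combination of Haar moments
  have step1 : ∫ g, ∏ k, (r.ρ g * L k * r.ρ g⁻¹) (a k) (b k) ∂haarProbability G =
      ∑ c : κ → Fin r.N, ∑ e : κ → Fin r.N, (∏ k, L k (c k) (e k)) * haarMoment r (a, b) (c, e) := by
    have e : (fun g : G => ∏ k, (r.ρ g * L k * r.ρ g⁻¹) (a k) (b k)) =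
        fun g => ∑ c : κ → Fin r.N, ∑ e : κ → Fin r.N, (∏ k, L k (c k) (e k)) *
          ((∏ k, r.ρ g (a k) (c k)) * conj (∏ k, r.ρ g (b k) (e k))) :=
      funext fun g => prod_conj_apply_eq_sum g L a b
    rw [e, integral_finsetSum _ (fun c _ => integrable_finsetSum _ fun e _ =>
      (integrable_momentIntegrand a c b e).const_mul _)]
    refine sum_congr rfl fun c _ => ?_
    rw [integral_finsetSum _ (fun e _ => (integrable_momentIntegrand a c b e).const_mul _)]
    refine sum_congr rfl fun e _ => ?_
    rw [integral_const_mul]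
    rfl
  -- step 2: the twisted trace against a slot permutation matrix
  have hτ : ∀ τ : Equiv.Perm κ, twistTrace τ L = ∑ c : κ → Fin r.N, ∑ e : κ → Fin r.N,
      (∏ k, L k (c k) (e k)) * (permMat τ : Matrix (κ → Fin r.N) (κ → Fin r.N) ℂ) c e := by
    intro τ
    rw [twistTrace_def]
    refine sum_congr rfl fun c _ => ?_
    simp only [permMat_apply, mul_ite, mul_one, mul_zero]
    rw [Finset.sum_ite_eq' univ (c ∘ ⇑τ)]
    simp only [mem_univ, if_true]
    rfl
  -- step 3: substitute the Weingarten form and exchange the sums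
  rw [step1]
  have e1 : (∑ c : κ → Fin r.N, ∑ e : κ → Fin r.N, (∏ k, L k (c k) (e k)) * haarMoment r (a, b) (c, e)) =
      ∑ c : κ → Fin r.N, ∑ e : κ → Fin r.N, ∑ σ : Equiv.Perm κ, ∑ τ : Equiv.Perm κ,
        (∏ k, L k (c k) (e k)) * (W σ τ *
          (permMat σ : Matrix (κ → Fin r.N) (κ → Fin r.N) ℂ) a b *
          (permMat τ : Matrix (κ → Fin r.N) (κ → Fin r.N) ℂ) c e) :=
    sum_congr rfl fun c _ => sum_congr rfl fun e _ => by
      rw [hW a b c e, Finset.mul_sum]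
      exact sum_congr rfl fun σ _ => Finset.mul_sum _ _ _
  -- exchange the four sums (the tree's `sum_comm_four` lives in an unrelated Literature file; inlined)
  have hcomm4 : ∀ f : (κ → Fin r.N) → (κ → Fin r.N) → Equiv.Perm κ → Equiv.Perm κ → ℂ,
      ∑ a, ∑ b, ∑ c, ∑ d, f a b c d = ∑ c, ∑ d, ∑ a, ∑ b, f a b c d := fun f =>
    calc ∑ a, ∑ b, ∑ c, ∑ d, f a b c d = ∑ a, ∑ c, ∑ b, ∑ d, f a b c d :=
          sum_congr rfl fun a _ => Finset.sum_comm
      _ = ∑ c, ∑ a, ∑ b, ∑ d, f a b c d := Finset.sum_comm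
      _ = ∑ c, ∑ a, ∑ d, ∑ b, f a b c d :=
          sum_congr rfl fun c _ => sum_congr rfl fun a _ => Finset.sum_comm
      _ = ∑ c, ∑ d, ∑ a, ∑ b, f a b c d := sum_congr rfl fun c _ => Finset.sum_comm
  rw [e1, hcomm4]
  refine sum_congr rfl fun σ _ => sum_congr rfl fun τ _ => ?_
  rw [hτ τ, Finset.mul_sum]
  refine sum_congr rfl fun c _ => ?_
  rw [Finset.mul_sum]
  refine sum_congr rfl fun e _ => ?_
  exact mul_left_comm _ _ _

end Haar

end TensorFFT

end Summit.QuantumFields.GaugeBoot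

end
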